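import Literature.NumberTheory.EllipticCurves.Kato2004.IwasawaH1CoeffTowerEngineProofs
import HarnessLib

/-!
# Kato 2004 (Astérisque 295) Thm. 12.4 (2) with coefficients, the `Λ`-part on the pin: `𝐇¹_Γ(T)` has no
# `ω_j`-torsion and no torsion by polynomials prime to every `ω_n`, when `(T ⊗ ℚ/T)^{Gal(ℚ̄/ℚ_∞)}` has
# bounded exponent (proofs only)

Topic `NumberTheory/EllipticCurves`, sub-directory `Kato2004` (namespace = path).  THEOREMS ONLY.  Fourth
file of seat `bsd-wall-tp2-p2x-w2` g23 on the print leaf K0b (`Kato2004.thm12_4_newform`, clause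
"`𝐇¹(T)` is a torsion free `Λ`-module"); it runs the engine of `IwasawaH1CoeffTowerEngineProofs` on a pin
`I : IwasawaH1DataCoeff T p κ γ` (`γ` a topological generator), under the element-wise hypothesis
  (HYP_J) every `m ∈ M` fixed by `Γ_∞ = Gal(ℚ̄/ℚ_∞)` modulo `p^{j+J} M` lies in `p^j M`
(i.e. `(M ⊗ ℚ/M)^{Γ_∞}` is killed by `p^J`; for a lattice in `V_{F_λ}(g)(1)`: "no `Γ_∞`-fixed line",
Kato (14.10.5)), together with `p`-adic precompleteness / separatedness of `M` (element-wise):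

* **`IwasawaH1DataCoeff.eq_zero_of_omega_smul_eq_zero`** — `((X+1)^{p^j} − 1) • y = 0 ⟹ y = 0`: the
  components `y_k` are `conj_{γ^{p^j}}`-fixed (`proj_coe_polynomial_smul`), hence `Γ_n`-fixed for
  `n ≥ j`; the tower makes each `y_n` an approximate coboundary, hence a coboundary.
* **`IwasawaH1DataCoeff.eq_zero_of_polynomial_smul_eq_zero`** — `P • x = 0 ⟹ x = 0` for `P ∈ A[X]`
  with a power of `p` in every ideal `(P, ω_n) ⊆ A[X]` (`M` Noetherian, `p` acting by an embedding):
  `x_n` is `p^{k_n}`-torsion, hence `p^J`-torsion (bounded torsion), so `C(p^J) • x = 0` and the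
  unconditional constant part `eq_zero_of_C_smul_eq_zero` concludes.

HONEST FRAMING: CONDITIONAL on (HYP_J); the assembly over `Λ_𝒪 = 𝒪⟦X⟧` (Weierstrass preparation,
cyclotomic factors via `minpoly`, resultants, completeness of `𝒪ⁿ`) is a sibling file; `thm12_4_newform`
stays a named fact; (HYP_J) for `T_ρ` is PRINT.  BSD is not advanced by this file.

## References

* [Kato2004Asterisque] K. Kato, Astérisque 295 (2004): Thm. 12.4 (2) (p. 221), §13.8 (pp. 228–229),
  (14.10.5) (p. 241).
* [SerreGaloisCohomology1997] J.-P. Serre, *Galois Cohomology*, I §2.2–2.4.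
-/

noncomputable section

open scoped NumberField
open Field CategoryTheory Topology Polynomial
open Literature.NumberTheory.GaloisRepresentations
open Literature.NumberTheory.EllipticCurves Literature.NumberTheory.EllipticCurves.Kato2004
open Literature.NumberTheory.EllipticCurves.Kato2004.EulerSystemValues

namespace Literature.NumberTheory.EllipticCurves.Kato2004

/-! ## §F On the pin: no `ω_j`-torsion and no torsion by polynomials prime to all `ω_n` -/

namespace IwasawaH1DataCoeff

variable {A : Type} [CommRing A] [TopologicalSpace A] {M : Type} [AddCommGroup M] [Module A M]
  [TopologicalSpace M] [IsTopologicalAddGroup M] [ContinuousSMul A M]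
  {T : GaloisRep ℚ A M} {p : ℕ} [Fact p.Prime] {κ : ZpExtension ℚ p} {γ : absoluteGaloisGroup ℚ}

/-- **No `ω_j`-torsion in `𝐇¹_Γ(T)` under (HYP_J).**  For any pin `I : IwasawaH1DataCoeff T p κ γ` (`γ` a
topological generator), `M` `p`-adically precomplete and separated (element-wise hypotheses) and
(HYP_J): `((X+1)^{p^j} − 1) • y = 0 ⟹ y = 0`.  The components `y_k` are `conj_{γ^{p^j}}`-fixed
(`proj_coe_polynomial_smul`), hence `Γ_n`-fixed for `n ≥ j`, so each `y_n` (`n ≥ j`) is an approximate,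
hence exact, coboundary; lower levels follow along `Cor`.  (Classes killed by `ω_j` are the ones Kato's
§13.8 controls through `H⁰(ℤ[ζ_{p^n}], T ⊗ Λ/ω_j)`, i.e. through `T^{Gal(ℚ̄/ℚ_∞)}`, which (HYP) kills.)
[cite: Kato2004Asterisque, Thm. 12.4 (2) (p. 221) and §13.8 (pp. 228–229)] -/
theorem eq_zero_of_omega_smul_eq_zero (I : IwasawaH1DataCoeff T p κ γ) (hγ : κ.IsTopGenerator γ)
    (J : ℕ)
    (hJ : ∀ (j : ℕ) (m : M), (∀ g ∈ κ.kerSubgroup, ∃ t : M, (p : A) ^ (j + J) • t = T g m - m) →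
      ∃ t : M, (p : A) ^ j • t = m)
    (hprec : ∀ f : ℕ → M, (∀ k, ∃ t : M, (p : A) ^ k • t = f (k + 1) - f k) →
      ∃ L : M, ∀ k, ∃ t : M, (p : A) ^ k • t = f k - L)
    (hhaus : ∀ m : M, (∀ k, ∃ t : M, (p : A) ^ k • t = m) → m = 0)
    (j : ℕ) (y : I.H) (hy : (((X + 1 : A[X]) ^ p ^ j - 1 : A[X]) : PowerSeries A) • y = 0) :
    y = 0 := by
  -- every component is fixed by `γ^{p^j}`
  have hfix : ∀ k, conjMap T.toTopRep (κ.layerSubgroup k) (γ ^ p ^ j) 1 (I.proj k y) = I.proj k y := by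
    intro k
    have h := I.proj_coe_polynomial_smul ((X + 1 : A[X]) ^ p ^ j - 1) k y
    rw [hy, map_zero] at h
    simp only [map_sub, map_pow, map_add, aeval_X, map_one, sub_add_cancel, LinearMap.sub_apply,
      Module.End.one_apply] at h
    rw [← conjMap_toLinearMap_pow_apply]
    exact sub_eq_zero.mp h.symm
  -- hence, for `n ≥ j`, the components of level `≥ n` are fixed by all of `Γ_n`
  have hinv : ∀ n, j ≤ n → ∀ k, n ≤ k → ∀ g ∈ κ.layerSubgroup n,
      conjMap T.toTopRep (κ.layerSubgroup k) g 1 (I.proj k y) = I.proj k y :=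
    fun n hjn k hnk g hg ↦ IwasawaH1CoeffTorsionFree.conjMap_eq_self_of_pow T κ hγ (hjn.trans hnk)
      (I.proj k y) (hfix k) (κ.layerSubgroup_antitone hjn hg)
  -- the components of level `n ≥ j` vanish: approximate coboundaries are coboundaries
  have hge : ∀ n, j ≤ n → I.proj n y = 0 := by
    intro n hjn
    obtain ⟨c, hc⟩ := oneCocycleClass_surjective _ (I.proj n y)
    rw [← hc]
    exact IwasawaH1CoeffTorsionFree.oneCocycleClass_eq_zero_of_forall_approx T κ J hJ hprec hhaus n c
      (IwasawaH1CoeffTorsionFree.exists_approx_coboundary_of_invariant T κ J hJ (fun k ↦ I.proj k y)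
        (fun k ↦ I.cores_proj k y) n (hinv n hjn) c hc)
  -- then all components vanish (downwards along the trace maps)
  have hall : ∀ m n, j ≤ n + m → I.proj n y = 0 := by
    intro m
    induction m with
    | zero => exact fun n hn ↦ hge n (by simpa using hn)
    | succ m ih =>
      intro n hn
      rw [← I.cores_proj n y, ih (n + 1) (by omega), map_zero]
  exact I.proj_injective y fun n ↦ hall j n (Nat.le_add_left j n)

omit [TopologicalSpace A] [IsTopologicalAddGroup M] [ContinuousSMul A M] in
/-- Powers of a scalar acting by an embedding act by embeddings. [folklore] -/
private theorem isEmbedding_pow_smul {a : A} (ha : IsEmbedding fun v : M ↦ a • v) (k : ℕ) :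
    IsEmbedding fun v : M ↦ a ^ k • v := by
  induction k with
  | zero => simp only [pow_zero, one_smul]; exact IsEmbedding.id
  | succ k ih =>
    have : (fun v : M ↦ a ^ (k + 1) • v) = (fun v : M ↦ a • v) ∘ (fun v : M ↦ a ^ k • v) := by
      funext v; simp only [Function.comp_apply, smul_smul, pow_succ']
    rw [this]
    exact ha.comp ih

/-- **No torsion by polynomials prime to every `ω_n`, under (HYP_J).**  For any pin over a Noetherian `M`
on which `p` acts by a topological embedding, and `P ∈ A[X]` such that every ideal `(P, ω_n) ⊆ A[X]`
contains a power of `p` (e.g. `Res(P, ω_n)` divides a power of `p`): `P • x = 0 ⟹ x = 0`.  Indeed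
`P(θ_n − 1) x_n = 0 = ω_n(θ_n − 1) x_n` make `x_n` `p^{k_n}`-torsion, hence `p^J`-torsion (§A), so
`C(p^J) • x = 0` and the constant part `eq_zero_of_C_smul_eq_zero` concludes.
[cite: Kato2004Asterisque, Thm. 12.4 (2) (p. 221) and §13.8 (pp. 228–229)] -/
theorem eq_zero_of_polynomial_smul_eq_zero [IsNoetherian A M] (I : IwasawaH1DataCoeff T p κ γ)
    (hγ : κ.IsTopGenerator γ) (ha : IsEmbedding fun v : M ↦ (p : A) • v) (J : ℕ)
    (hJ : ∀ (j : ℕ) (m : M), (∀ g ∈ κ.kerSubgroup, ∃ t : M, (p : A) ^ (j + J) • t = T g m - m) →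
      ∃ t : M, (p : A) ^ j • t = m)
    (P : A[X]) (hP : ∀ n : ℕ, ∃ (U V : A[X]) (k : ℕ),
      U * P + V * ((X + 1 : A[X]) ^ p ^ n - 1) = Polynomial.C ((p : A) ^ k))
    (x : I.H) (hx : (P : PowerSeries A) • x = 0) : x = 0 := by
  -- every component is killed by a power of `p`
  have htors : ∀ n, ∃ k : ℕ, (p : A) ^ k • I.proj n x = 0 := by
    intro n
    obtain ⟨U, V, k, hUV⟩ := hP n
    refine ⟨k, ?_⟩
    have hPx : aeval ((conjMap T.toTopRep (κ.layerSubgroup n) γ 1).hom.toLinearMap - 1) P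
        (I.proj n x) = 0 := by
      rw [← I.proj_coe_polynomial_smul, hx, map_zero]
    have hωx := I.proj_omega_smul hγ n x
    rw [I.proj_coe_polynomial_smul] at hωx
    have h := congrArg (fun Q : A[X] ↦
      aeval ((conjMap T.toTopRep (κ.layerSubgroup n) γ 1).hom.toLinearMap - 1) Q (I.proj n x)) hUV
    simp only [map_add, map_mul, LinearMap.add_apply, Module.End.mul_apply, hPx, hωx, map_zero,
      add_zero, Polynomial.aeval_C, Module.algebraMap_end_apply] at h
    exact h.symm
  -- hence by `p^J` (bounded invariants), uniformly in `n`
  have hinj : ∀ k : ℕ, Function.Injective fun v : M ↦ (p : A) ^ k • v :=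
    fun k ↦ (isEmbedding_pow_smul ha k).injective
  have hJx : ∀ n, (p : A) ^ J • I.proj n x = 0 := fun n ↦ by
    obtain ⟨k, hk⟩ := htors n
    exact IwasawaH1CoeffTorsionFree.pow_smul_eq_zero_of_pow_smul_eq_zero T κ (p : A) J hinj hJ n k _ hk
  -- so `C(p^J) • x = 0`, and the constant part of Thm. 12.4 (2) concludes
  have hC : (PowerSeries.C ((p : A) ^ J) : PowerSeries A) • x = 0 :=
    I.proj_injective _ fun n ↦ by rw [I.proj_C_smul, hJx]
  exact I.eq_zero_of_C_smul_eq_zero (isEmbedding_pow_smul ha J) (Ideal.mem_span_singleton_self _) x hC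

end IwasawaH1DataCoeff

end Literature.NumberTheory.EllipticCurves.Kato2004

end
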